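import Literature.NumberTheory.Transcendental.KZIntervalPeriodProofs
import Literature.NumberTheory.Transcendental.SemialgebraicLineDeriv
import Literature.NumberTheory.Transcendental.SemialgebraicAlgebraicPoints
import Literature.NumberTheory.Transcendental.KZCubicalCalculus
import Mathlib.Analysis.Calculus.Deriv.Basic

/-!
# `StokesGeneration` (stmt-KontsevichZagierPeriods-3586) — line `fibrewise_stokes`, stub `stub_rungExactElement`

Registered rung stub R7 of the line `fibrewise_stokes` of the crux `StokesGeneration` (route
UnfoldedStokes): **the exact part of a dlog-sector integrand is ONE fibrewise Stokes element** on the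
closed square `[0,1]²`, in direction `0` (the coordinate `x 1` is a dummy padding variable).

Let `G₀` be continuous on `[0,1]`, differentiable on `(0,1)` with derivative `g₀` continuous on
`[0,1]`, both `ℚ`-semialgebraic as functions of `x 0` on the square. The fibrewise Stokes element with
primitive `G x = G₀ (x 0)` and fibre derivative `D x = g₀ (x 0)` has integrand
`D − (G|_{x₀=1} − G|_{x₀=0}) = g₀ (x 0) − (G₀ 1 − G₀ 0)`, carried by the closed square (a compact
`ℚ`-semialgebraic set) with a continuous, hence integrable, integrand; `G` is bounded on the square
because `G₀` is bounded on the compact interval. The one non-formal point is the `ℚ`-semialgebraicity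
of the CONSTANT `G₀ 1 − G₀ 0`: a constant function is `ℚ`-semialgebraic iff its value is algebraic
(`isSemialgebraicFunOn_const_of_isAlgebraic`), and `G₀ 1`, `G₀ 0` ARE algebraic, being values of the
`ℚ`-semialgebraic function `x ↦ G₀ (x 0)` at the rational corners `(1,1)`, `(0,0)` of the square
(`IsSemialgebraicFunOn.isAlgebraic_apply`: the fibre of the graph over an algebraic point is a
`ℚ`-semialgebraic singleton of the line, Bochnak–Coste–Roy §2.1 with Tarski–Seidenberg).

References: M. Kontsevich, D. Zagier, *Periods* (2001), §1.2 (rule (3), Newton–Leibniz/Stokes);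
J. Bochnak, M. Coste, M.-F. Roy, *Real Algebraic Geometry* (1998), §2.1 and Prop. 2.2.6.
-/

noncomputable section

-- `Summit.KontsevichZagierPeriods.KontsevichZagierPeriods.…` is the tree's mandated layout (single-conjunct summit).
set_option linter.dupNamespace false

namespace Summit.KontsevichZagierPeriods.KontsevichZagierPeriods.Cruxes.StokesGeneration.FibrewiseStokes

open MeasureTheory Set
open Literature.NumberTheory.Transcendental
open Literature.NumberTheory.Transcendental.KZ
open Literature.ModelTheory.ExponentialFields (IsSemialgebraic)

/-- **Registered stub `stub_rungExactElement` (rung 2, R7): the exact part is one fibrewise Stokes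
element** (direction `0`, no kink set): for `G₀` continuous on `[0,1]`, differentiable on `(0,1)` with
derivative `g₀` continuous on `[0,1]`, both `ℚ`-semialgebraic as functions of `x 0` on the square, the
element with primitive `x ↦ G₀ (x 0)` and fibre derivative `x ↦ g₀ (x 0)` is carried by the closed
square with integrand `g₀ (x 0) − (G₀ 1 − G₀ 0)` (the constant is algebraic as a difference of values of
a `ℚ`-semialgebraic function at rational points). [cite: KontsevichZagier2001, §1.2 rule (3)] -/
theorem stub_rungExactElement :
    ∀ (G₀ g₀ : ℝ → ℝ),
      IsSemialgebraicFunOn ℚ (Set.pi Set.univ (fun _ : Fin 2 => Set.Icc (0:ℝ) 1)) (fun x => G₀ (x 0)) →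
      IsSemialgebraicFunOn ℚ (Set.pi Set.univ (fun _ : Fin 2 => Set.Icc (0:ℝ) 1)) (fun x => g₀ (x 0)) →
      ContinuousOn G₀ (Set.Icc (0:ℝ) 1) → ContinuousOn g₀ (Set.Icc (0:ℝ) 1) →
      (∀ u ∈ Set.Ioo (0:ℝ) 1, HasDerivAt G₀ (g₀ u) u) →
      ∃ (G D : (Fin 2 → ℝ) → ℝ) (q : IntegralRep 2),
        (IsSemialgebraicFunOn ℚ (Set.pi Set.univ (fun _ : Fin 2 => Set.Icc (0:ℝ) 1)) G ∧
          IsSemialgebraicFunOn ℚ (Set.pi Set.univ (fun _ : Fin 2 => Set.Icc (0:ℝ) 1)) D ∧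
          (∃ B : ℝ, ∀ x ∈ Set.pi Set.univ (fun _ : Fin 2 => Set.Icc (0:ℝ) 1), |G x| ≤ B) ∧
          (∀ x ∈ Set.pi Set.univ (fun _ : Fin 2 => Set.Icc (0:ℝ) 1),
            ContinuousOn (fun s : ℝ => G (Function.update x 0 s)) (Set.Icc (0:ℝ) 1)) ∧
          (∀ x ∈ Set.pi Set.univ (fun _ : Fin 2 => Set.Icc (0:ℝ) 1), x 0 ∈ Set.Ioo (0:ℝ) 1 →
            HasDerivAt (fun s : ℝ => G (Function.update x 0 s)) (D x) (x 0))) ∧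
        (q.domain = Set.pi Set.univ (fun _ : Fin 2 => Set.Icc (0:ℝ) 1) ∧
          ∀ x ∈ Set.pi Set.univ (fun _ : Fin 2 => Set.Icc (0:ℝ) 1), q.integrand x =
            D x - (G (Function.update x 0 1) - G (Function.update x 0 0))) ∧
        ∀ x ∈ Set.pi Set.univ (fun _ : Fin 2 => Set.Icc (0:ℝ) 1), q.integrand x = g₀ (x 0) - (G₀ 1 - G₀ 0) := by
  intro G₀ g₀ hG₀ hg₀ hG₀c hg₀c hder
  -- the closed square and what holds on it
  set S : Set (Fin 2 → ℝ) := Set.pi Set.univ (fun _ : Fin 2 => Set.Icc (0:ℝ) 1) with hS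
  have hSsa : IsSemialgebraic ℚ S := by rw [hS, ← cube_eq_pi]; exact isSemialgebraic_cube
  have hSc : IsCompact S := isCompact_univ_pi fun _ => isCompact_Icc
  have hmem : ∀ x ∈ S, ∀ i, x i ∈ Set.Icc (0:ℝ) 1 := fun x hx i => (Set.mem_univ_pi.mp hx) i
  have hdiag : ∀ c ∈ Set.Icc (0:ℝ) 1, (fun _ : Fin 2 => c) ∈ S := fun c hc =>
    Set.mem_univ_pi.mpr fun _ => hc
  -- the boundary values `G₀ 1`, `G₀ 0` are algebraic: values of a `ℚ`-semialgebraic function at the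
  -- rational corners `(1,1)`, `(0,0)` of the square
  have h1alg : IsAlgebraic ℚ (G₀ 1) :=
    hG₀.isAlgebraic_apply (a := fun _ => (1:ℝ)) (hdiag 1 ⟨zero_le_one, le_rfl⟩)
      fun _ => isAlgebraic_one
  have h0alg : IsAlgebraic ℚ (G₀ 0) :=
    hG₀.isAlgebraic_apply (a := fun _ => (0:ℝ)) (hdiag 0 ⟨le_rfl, zero_le_one⟩)
      fun _ => isAlgebraic_zero
  have hκ : IsAlgebraic ℚ (G₀ 1 - G₀ 0) := h1alg.sub h0alg
  -- the integrand of the element: semialgebraic (BCR Prop. 2.2.6) and continuous on the square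
  have hIsa : IsSemialgebraicFunOn ℚ S (fun x => g₀ (x 0) - (G₀ 1 - G₀ 0)) :=
    hg₀.fun_sub (isSemialgebraicFunOn_const_of_isAlgebraic hSsa hκ)
  have hg₀S : ContinuousOn (fun x : Fin 2 → ℝ => g₀ (x 0)) S :=
    hg₀c.comp (continuous_apply 0).continuousOn fun x hx => hmem x hx 0
  have hIc : ContinuousOn (fun x : Fin 2 → ℝ => g₀ (x 0) - (G₀ 1 - G₀ 0)) S :=
    hg₀S.sub continuousOn_const
  -- the primitive is bounded on the square (it only sees `x 0 ∈ [0,1]`, a compact interval)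
  have hGbd : ∃ B : ℝ, ∀ x ∈ S, |G₀ (x 0)| ≤ B := by
    obtain ⟨B, hB⟩ := isCompact_Icc.exists_bound_of_continuousOn hG₀c
    exact ⟨B, fun x hx => by simpa only [Real.norm_eq_abs] using hB (x 0) (hmem x hx 0)⟩
  -- the closed-square representation of the element
  let q : IntegralRep 2 :=
    { domain := S
      integrand := fun x => g₀ (x 0) - (G₀ 1 - G₀ 0)
      isSemialgebraic_domain := hSsa
      isSemialgebraicFunOn_integrand := hIsa
      integrableOn := hIc.integrableOn_compact hSc }
  refine ⟨fun x => G₀ (x 0), fun x => g₀ (x 0), q,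
    ⟨hG₀, hg₀, hGbd, fun x _ => ?_, fun x _ hx0 => ?_⟩, ⟨rfl, fun x _ => ?_⟩, fun x _ => rfl⟩
  · -- continuity along the closed fibre: the fibre function IS `G₀`
    simp only [Function.update_self]
    exact hG₀c
  · -- derivative along the open fibre at `s = x 0`: the hypothesis
    simp only [Function.update_self]
    exact hder _ hx0
  · -- the integrand clause: `G (update x 0 1) = G₀ 1`, `G (update x 0 0) = G₀ 0`
    show g₀ (x 0) - (G₀ 1 - G₀ 0) =
      g₀ (x 0) - (G₀ (Function.update x 0 1 0) - G₀ (Function.update x 0 0 0))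
    simp only [Function.update_self]

end Summit.KontsevichZagierPeriods.KontsevichZagierPeriods.Cruxes.StokesGeneration.FibrewiseStokes
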